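import Mathlib.Probability.Moments.Tilted
import Mathlib.Analysis.Calculus.Darboux
import Mathlib.Analysis.Convex.Deriv
import HarnessLib

/-!
# A forbidden energy band in finite volume forces a first-order transition (non-differentiable
# pressure): the thermodynamic half of the Kotecký–Shlosman / van Enter–Shlosman argument

Setting: a sequence of probability spaces `(Ω n, μ n)` (the a-priori measures of the finite
volumes, e.g. product Haar measures on tori), bounded measurable "energies" `H n : Ω n → ℝ`,
volumes `V n → ∞`, the finite-volume pressures `p_n(J) = (V n)⁻¹ log ∫ exp (J · H n) dμ n`
(`= (V n)⁻¹ · cgf (H n) (μ n) J`), their pointwise limit `P` (the pressure), and the finite-volume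
Gibbs measures `(μ n).tilted (J · H n)` (Mathlib's exponential tilt
`dμ_J = e^{J H} dμ / ∫ e^{J H} dμ`).

* `cgf_tilted_mul`, `real_tilted_ge_le`, `real_tilted_le_le`: the moment generating function of
  `H` under the Gibbs measure at `J` is `Z(J+t)/Z(J)`, whence the exponential Chebyshev (Chernoff)
  bounds `μ_J(H ≥ x) ≤ exp(-t x + log Z(J+t) - log Z(J))` (`t ≥ 0`) and the lower-tail twin.
* `convexOn_pressure`: the limiting pressure is convex (limit of the convex `p_n`).
* **`tendsto_real_tilted_deviation`** (concentration from differentiability): if `P` is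
  differentiable at `J`, the energy density `H n / V n` concentrates at `P'(J)` under the Gibbs
  measures at `J`: `μ_{n,J}(|H n / V n - P'(J)| ≥ η) → 0` for every `η > 0` (exponentially, by the
  Chernoff bound with `t → 0±` chosen from the derivative).
* **`exists_not_differentiableAt_of_forbidden_band`** (the criterion): if on a coupling interval
  `[J₁, J₂]` a secant slope of `P` to the right of `J₁` is `≤ a`, a secant slope to the left of
  `J₂` is `≥ b`, `a < b`, and for every `J ∈ [J₁, J₂]` the Gibbs probability of the FORBIDDEN BAND
  `{H n / V n ∈ (a, b)}` stays `≤ θ_J < 1` along a subsequence of volumes, then `P` is not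
  differentiable at some `J ∈ [J₁, J₂]`. Proof: otherwise `P' = deriv P` is a derivative on
  `[J₁, J₂]` with `P'(J₁) ≤ a < b ≤ P'(J₂)` (convexity), Darboux gives `J⋆` with
  `P'(J⋆) = (a+b)/2`, and concentration at `J⋆` puts Gibbs mass `→ 1` inside the band.

This is the model-independent "thermodynamic" step by which reflection-positivity proofs of
temperature-driven first-order transitions conclude (Kotecký–Shlosman 1982; van Enter–Shlosman
2002/2005; Biskup–Kotecký 2006, Cor. 2, where the conclusion is phrased through infinite-volume
Gibbs states): the model-specific input is exactly the forbidden-band estimate, obtained there from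
chessboard estimates and a Peierls argument. Here everything is finite-volume and proved; no named
facts are introduced (D-0014, D-0026). Written as the first layer under the named fact
`Literature.MathematicalPhysics.QuantumLattice.enterShlosman_narrowWell_firstOrderTransition`
(van Enter–Shlosman 2005, Thm. 2).

## References

* R. Kotecký, S. B. Shlosman, Comm. Math. Phys. 83 (1982) 493–515 [KoteckyShlosman1982].
* M. Biskup, R. Kotecký, Comm. Math. Phys. 264 (2006) 631–656, Thm. 1, Cor. 2 [BiskupKotecky2006].
* A. C. D. van Enter, S. B. Shlosman, Comm. Math. Phys. 255 (2005) 21–32 [VanEnterShlosman2005].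
* S. Friedli, Y. Velenik, *Statistical Mechanics of Lattice Systems*, CUP 2017, §3.2, App. B.2
  (convexity, one-sided derivatives of the pressure) [FriedliVelenik2017].
-/

noncomputable section

namespace Literature.Probability.LatticeModels

open _root_.MeasureTheory _root_.ProbabilityTheory _root_.Filter _root_.Set
open scoped Topology

namespace ForbiddenGap

/-! ### One volume: the Gibbs tilt, its moment generating function and the Chernoff bounds -/

section OneVolume

variable {Ω : Type*} [MeasurableSpace Ω] {μ : Measure Ω} [IsProbabilityMeasure μ] {X : Ω → ℝ}
  {C : ℝ}

/-- A measurable function bounded by `C` has all exponential moments under a finite measure.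
[folklore] -/
theorem integrable_exp_mul_of_abs_le {ν : Measure Ω} [IsFiniteMeasure ν] (hX : Measurable X)
    (hC : ∀ ω, |X ω| ≤ C) (t : ℝ) : Integrable (fun ω => Real.exp (t * X ω)) ν :=
  integrable_exp_mul_of_mem_Icc (a := -C) (b := C) hX.aemeasurable
    (ae_of_all _ fun ω => abs_le.1 (hC ω))

/-- The cumulant generating function `t ↦ log ∫ e^{tX} dμ` of a bounded measurable `X` is convex
on `ℝ` (its second derivative is a variance; Mathlib `iteratedDeriv_two_cgf_eq_integral`).
[cite: FriedliVelenik2017, Lemma 3.5 / App. B.2 (convexity of the pressure, Hölder)] -/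
theorem convexOn_cgf (hX : Measurable X) (hC : ∀ ω, |X ω| ≤ C) : ConvexOn ℝ univ (cgf X μ) := by
  have hI : integrableExpSet X μ = Set.univ :=
    Set.eq_univ_of_forall fun t => integrable_exp_mul_of_abs_le hX hC t
  have hmem : ∀ t, t ∈ interior (integrableExpSet X μ) := fun t => by
    rw [hI, interior_univ]
    exact Set.mem_univ t
  have han : ∀ t, AnalyticAt ℝ (cgf X μ) t := fun t => analyticAt_cgf (hmem t)
  have hd : Differentiable ℝ (cgf X μ) := fun t => (han t).differentiableAt
  have hd2 : Differentiable ℝ (deriv (cgf X μ)) := fun t => (han t).deriv.differentiableAt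
  refine convexOn_univ_of_deriv2_nonneg hd hd2 fun t => ?_
  rw [← iteratedDeriv_eq_iterate, iteratedDeriv_two_cgf_eq_integral (hmem t)]
  exact div_nonneg (integral_nonneg fun ω => by positivity) mgf_nonneg

omit [IsProbabilityMeasure μ] in
/-- **The moment generating function under the Gibbs tilt**: for the tilted measure
`dμ_s = e^{sX} dμ / ∫ e^{sX} dμ`, `∫ e^{tX} dμ_s = mgf (s + t) / mgf s`. [folklore] -/
theorem mgf_tilted_mul (s t : ℝ) :
    mgf X (μ.tilted fun ω => s * X ω) t = mgf X μ (s + t) / mgf X μ s := by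
  rw [mgf, integral_tilted_mul_eq_mgf]
  simp_rw [smul_eq_mul, div_mul_eq_mul_div, ← Real.exp_add, ← add_mul]
  rw [integral_div]
  rfl

/-- **The cumulant generating function under the Gibbs tilt** is a difference quotient numerator
of the original one: `cgf_{μ_s}(t) = cgf (s + t) - cgf s` (`= log Z(s+t) - log Z(s)`).
[folklore] -/
theorem cgf_tilted_mul (hX : Measurable X) (hC : ∀ ω, |X ω| ≤ C) (s t : ℝ) :
    cgf X (μ.tilted fun ω => s * X ω) t = cgf X μ (s + t) - cgf X μ s := by
  rw [cgf, mgf_tilted_mul, Real.log_div (mgf_pos (integrable_exp_mul_of_abs_le hX hC _)).ne'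
    (mgf_pos (integrable_exp_mul_of_abs_le hX hC _)).ne', cgf, cgf]

/-- The Gibbs tilt of a probability measure by a bounded energy is a probability measure.
[folklore] -/
theorem isProbabilityMeasure_tilted_mul (hX : Measurable X) (hC : ∀ ω, |X ω| ≤ C) (s : ℝ) :
    IsProbabilityMeasure (μ.tilted fun ω => s * X ω) :=
  isProbabilityMeasure_tilted (integrable_exp_mul_of_abs_le hX hC s)

/-- **Exponential Chebyshev (Chernoff) bound under the Gibbs measure, upper tail**:
`μ_s(X ≥ x) ≤ exp (-t x + cgf (s+t) - cgf s)` for `t ≥ 0`. [folklore] -/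
theorem real_tilted_ge_le (hX : Measurable X) (hC : ∀ ω, |X ω| ≤ C) (s : ℝ) {t : ℝ} (ht : 0 ≤ t)
    (x : ℝ) :
    (μ.tilted fun ω => s * X ω).real {ω | x ≤ X ω} ≤
      Real.exp (-t * x + (cgf X μ (s + t) - cgf X μ s)) := by
  rw [← cgf_tilted_mul hX hC s t]
  exact measure_ge_le_exp_cgf x ht (integrable_exp_mul_of_abs_le hX hC t)

/-- **Exponential Chebyshev (Chernoff) bound under the Gibbs measure, lower tail**:
`μ_s(X ≤ x) ≤ exp (-t x + cgf (s+t) - cgf s)` for `t ≤ 0`. [folklore] -/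
theorem real_tilted_le_le (hX : Measurable X) (hC : ∀ ω, |X ω| ≤ C) (s : ℝ) {t : ℝ} (ht : t ≤ 0)
    (x : ℝ) :
    (μ.tilted fun ω => s * X ω).real {ω | X ω ≤ x} ≤
      Real.exp (-t * x + (cgf X μ (s + t) - cgf X μ s)) := by
  rw [← cgf_tilted_mul hX hC s t]
  exact measure_le_le_exp_cgf x ht (integrable_exp_mul_of_abs_le hX hC t)

end OneVolume

/-! ### A sequence of volumes: the pressure and its convexity -/

section Volumes

variable {Ω : ℕ → Type*} [∀ n, MeasurableSpace (Ω n)] {μ : ∀ n, Measure (Ω n)}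
  [∀ n, IsProbabilityMeasure (μ n)] {H : ∀ n, Ω n → ℝ} {V : ℕ → ℝ} {P : ℝ → ℝ}

/-- **The limiting pressure is convex**: if `(V n)⁻¹ cgf (H n) (μ n) J → P J` for every `J`
(`V n > 0`, `H n` bounded measurable), then `P` is convex on `ℝ`. [cite: FriedliVelenik2017, Lemma 3.5 and Thm. 3.6 (convexity passes to the thermodynamic limit)] -/
theorem convexOn_pressure (hH : ∀ n, Measurable (H n)) (hbd : ∀ n, ∃ C, ∀ ω, |H n ω| ≤ C)
    (hV0 : ∀ n, 0 < V n)
    (hP : ∀ J, Tendsto (fun n => (V n)⁻¹ * cgf (H n) (μ n) J) atTop (𝓝 (P J))) :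
    ConvexOn ℝ univ P := by
  refine ⟨convex_univ, fun x _ y _ a b ha hb hab => ?_⟩
  have hconv : ∀ n, ConvexOn ℝ univ (fun J => (V n)⁻¹ * cgf (H n) (μ n) J) := fun n => by
    obtain ⟨C, hC⟩ := hbd n
    exact (convexOn_cgf (μ := μ n) (hH n) hC).smul (inv_nonneg.2 (hV0 n).le)
  refine le_of_tendsto_of_tendsto' (hP (a • x + b • y)) ((hP x).const_smul a |>.add
    ((hP y).const_smul b)) fun n => ?_
  exact (hconv n).2 (mem_univ x) (mem_univ y) ha hb hab

/-! ### Concentration of the energy density where the pressure is differentiable -/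

/-- **Concentration from differentiability of the pressure.** If the finite-volume pressures
`(V n)⁻¹ log ∫ e^{J H n} dμ n` converge to `P J` for every `J`, `V n → ∞`, and `P` is
differentiable at `J`, then under the Gibbs measures at `J` the energy density `H n / V n`
concentrates at `P'(J)`: `μ_{n,J}(|H n/V n - deriv P J| ≥ η) → 0` for every `η > 0`
(exponential Chebyshev with `±t`, `t ↓ 0` chosen from the derivative). [folklore] -/
theorem tendsto_real_tilted_deviation (hH : ∀ n, Measurable (H n))
    (hbd : ∀ n, ∃ C, ∀ ω, |H n ω| ≤ C) (hV : Tendsto V atTop atTop) (hV0 : ∀ n, 0 < V n)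
    (hP : ∀ J, Tendsto (fun n => (V n)⁻¹ * cgf (H n) (μ n) J) atTop (𝓝 (P J)))
    {J : ℝ} (hdiff : DifferentiableAt ℝ P J) {η : ℝ} (hη : 0 < η) :
    Tendsto (fun n => ((μ n).tilted fun ω => J * H n ω).real
      {ω | η ≤ |H n ω / V n - deriv P J|}) atTop (𝓝 0) := by
  set c := deriv P J with hc
  -- the slopes of `P` at `J` tend to `c`
  have hslope : Tendsto (fun t => t⁻¹ * (P (J + t) - P J)) (𝓝[≠] 0) (𝓝 c) := by
    have h := hdiff.hasDerivAt.tendsto_slope_zero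
    simpa only [smul_eq_mul] using h
  have hη2 : 0 < η / 2 := by linarith
  -- a positive `t₀` with `P (J + t₀) - P J ≤ t₀ (c + η/2)`
  obtain ⟨t₀, ht₀, hPt₀⟩ : ∃ t₀ : ℝ, 0 < t₀ ∧ P (J + t₀) - P J ≤ t₀ * (c + η / 2) := by
    have h1 : ∀ᶠ t in 𝓝[>] (0 : ℝ), t⁻¹ * (P (J + t) - P J) < c + η / 2 :=
      (hslope.mono_left (nhdsGT_le_nhdsNE 0)).eventually (gt_mem_nhds (by linarith))
    have h2 : ∀ᶠ t in 𝓝[>] (0 : ℝ), (0 : ℝ) < t := eventually_mem_nhdsWithin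
    obtain ⟨t, ht1, ht2⟩ := (h1.and h2).exists
    refine ⟨t, ht2, ?_⟩
    have := (inv_mul_lt_iff₀ ht2).1 ht1
    linarith
  -- a negative `t₁` with `P (J + t₁) - P J ≤ t₁ (c - η/2)`
  obtain ⟨t₁, ht₁, hPt₁⟩ : ∃ t₁ : ℝ, t₁ < 0 ∧ P (J + t₁) - P J ≤ t₁ * (c - η / 2) := by
    have h1 : ∀ᶠ t in 𝓝[<] (0 : ℝ), c - η / 2 < t⁻¹ * (P (J + t) - P J) :=
      (hslope.mono_left (nhdsLT_le_nhdsNE 0)).eventually (lt_mem_nhds (by linarith))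
    have h2 : ∀ᶠ t in 𝓝[<] (0 : ℝ), t < (0 : ℝ) := eventually_mem_nhdsWithin
    obtain ⟨t, ht1, ht2⟩ := (h1.and h2).exists
    refine ⟨t, ht2, ?_⟩
    have h3 : t⁻¹ * (P (J + t) - P J) * t < (c - η / 2) * t := mul_lt_mul_of_neg_right ht1 ht2
    have ht0 : t ≠ 0 := ht2.ne
    have h4 : t⁻¹ * (P (J + t) - P J) * t = P (J + t) - P J := by
      field_simp
    linarith
  -- notation for the finite-volume pressures and Gibbs measures
  set p : ℕ → ℝ → ℝ := fun n K => (V n)⁻¹ * cgf (H n) (μ n) K with hp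
  have hcgf : ∀ n K, cgf (H n) (μ n) K = V n * p n K := fun n K => by
    have hVn : V n ≠ 0 := (hV0 n).ne'
    simp only [hp]
    field_simp
  -- upper tail
  have hup : Tendsto (fun n => ((μ n).tilted fun ω => J * H n ω).real
      {ω | V n * (c + η) ≤ H n ω}) atTop (𝓝 0) := by
    have hlim : Tendsto (fun n => p n (J + t₀) - p n J) atTop (𝓝 (P (J + t₀) - P J)) :=
      (hP (J + t₀)).sub (hP J)
    have hev : ∀ᶠ n in atTop, p n (J + t₀) - p n J < t₀ * (c + η / 2) + t₀ * (η / 4) :=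
      hlim.eventually (gt_mem_nhds (by nlinarith))
    have hbound : ∀ᶠ n in atTop, ((μ n).tilted fun ω => J * H n ω).real
        {ω | V n * (c + η) ≤ H n ω} ≤ Real.exp (-(t₀ * (η / 4)) * V n) := by
      filter_upwards [hev] with n hn
      obtain ⟨C, hC⟩ := hbd n
      refine (real_tilted_ge_le (μ := μ n) (hH n) hC J ht₀.le _).trans ?_
      rw [Real.exp_le_exp, hcgf, hcgf]
      have hVn := hV0 n
      nlinarith
    have hexp : Tendsto (fun n => Real.exp (-(t₀ * (η / 4)) * V n)) atTop (𝓝 0) :=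
      Real.tendsto_exp_atBot.comp ((tendsto_const_mul_atBot_of_neg (by nlinarith)).2 hV)
    exact squeeze_zero' (Eventually.of_forall fun n => measureReal_nonneg) hbound hexp
  -- lower tail
  have hlow : Tendsto (fun n => ((μ n).tilted fun ω => J * H n ω).real
      {ω | H n ω ≤ V n * (c - η)}) atTop (𝓝 0) := by
    have hlim : Tendsto (fun n => p n (J + t₁) - p n J) atTop (𝓝 (P (J + t₁) - P J)) :=
      (hP (J + t₁)).sub (hP J)
    have hev : ∀ᶠ n in atTop, p n (J + t₁) - p n J < t₁ * (c - η / 2) - t₁ * (η / 4) :=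
      hlim.eventually (gt_mem_nhds (by nlinarith))
    have hbound : ∀ᶠ n in atTop, ((μ n).tilted fun ω => J * H n ω).real
        {ω | H n ω ≤ V n * (c - η)} ≤ Real.exp (t₁ * (η / 4) * V n) := by
      filter_upwards [hev] with n hn
      obtain ⟨C, hC⟩ := hbd n
      refine (real_tilted_le_le (μ := μ n) (hH n) hC J ht₁.le _).trans ?_
      rw [Real.exp_le_exp, hcgf, hcgf]
      have hVn := hV0 n
      nlinarith
    have hexp : Tendsto (fun n => Real.exp (t₁ * (η / 4) * V n)) atTop (𝓝 0) :=
      Real.tendsto_exp_atBot.comp ((tendsto_const_mul_atBot_of_neg (by nlinarith)).2 hV)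
    exact squeeze_zero' (Eventually.of_forall fun n => measureReal_nonneg) hbound hexp
  -- union bound
  have hsub : ∀ n, {ω | η ≤ |H n ω / V n - c|} ⊆
      {ω | V n * (c + η) ≤ H n ω} ∪ {ω | H n ω ≤ V n * (c - η)} := by
    intro n ω hω
    simp only [mem_setOf_eq, mem_union] at hω ⊢
    have hVn := hV0 n
    rcases le_abs'.1 hω with h | h
    · right
      have : H n ω / V n ≤ c - η := by linarith
      rwa [div_le_iff₀ hVn, mul_comm] at this
    · left
      have : c + η ≤ H n ω / V n := by linarith
      rwa [le_div_iff₀ hVn, mul_comm] at this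
  refine squeeze_zero' (Eventually.of_forall fun n => measureReal_nonneg)
    (Eventually.of_forall fun n => ?_) (by simpa using hup.add hlow)
  exact (measureReal_mono (hsub n)).trans (measureReal_union_le _ _)

/-! ### The criterion -/

/-- **A forbidden energy band forces a first-order transition.** Let the finite-volume pressures
`(V n)⁻¹ log ∫ e^{J H n} dμ n` (bounded measurable `H n`, `V n → ∞`) converge to `P J` for every
real `J`. Suppose that on `[J₁, J₂]`: some secant slope of `P` to the right of `J₁` is `≤ a`, some
secant slope to the left of `J₂` is `≥ b`, `a < b`, and for every `J ∈ [J₁, J₂]` there is `θ < 1`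
such that, for infinitely many `n`, the Gibbs measure `(μ n)_J` gives the band
`{a < H n / V n < b}` probability at most `θ`. Then `P` fails to be differentiable at some
`J ∈ [J₁, J₂]`. (The thermodynamic step of the chessboard proofs of temperature-driven
first-order transitions; cf. Biskup–Kotecký 2006, Cor. 2, Kotecký–Shlosman 1982.) [folklore] -/
theorem exists_not_differentiableAt_of_forbidden_band (hH : ∀ n, Measurable (H n))
    (hbd : ∀ n, ∃ C, ∀ ω, |H n ω| ≤ C) (hV : Tendsto V atTop atTop) (hV0 : ∀ n, 0 < V n)
    (hP : ∀ J, Tendsto (fun n => (V n)⁻¹ * cgf (H n) (μ n) J) atTop (𝓝 (P J)))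
    {J₁ J₂ a b : ℝ} (hJ : J₁ ≤ J₂) (hab : a < b)
    (h₁ : ∃ J₁', J₁ < J₁' ∧ P J₁' - P J₁ ≤ a * (J₁' - J₁))
    (h₂ : ∃ J₂', J₂' < J₂ ∧ b * (J₂ - J₂') ≤ P J₂ - P J₂')
    (hband : ∀ J ∈ Icc J₁ J₂, ∃ θ : ℝ, θ < 1 ∧ ∃ᶠ n in atTop,
      ((μ n).tilted fun ω => J * H n ω).real {ω | H n ω / V n ∈ Ioo a b} ≤ θ) :
    ∃ J ∈ Icc J₁ J₂, ¬ DifferentiableAt ℝ P J := by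
  by_contra hcon
  simp only [not_exists, not_and, not_not] at hcon
  have hconv : ConvexOn ℝ univ P := convexOn_pressure hH hbd hV0 hP
  -- one-sided slope bounds at the endpoints
  obtain ⟨J₁', hJ₁', hP₁⟩ := h₁
  obtain ⟨J₂', hJ₂', hP₂⟩ := h₂
  have hd₁ : deriv P J₁ ≤ a := by
    have h := hconv.deriv_le_slope (mem_univ J₁) (mem_univ J₁') hJ₁'
      (hcon J₁ (left_mem_Icc.2 hJ))
    rw [slope_def_field] at h
    have hpos : 0 < J₁' - J₁ := sub_pos.2 hJ₁'
    exact h.trans ((div_le_iff₀ hpos).2 hP₁)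
  have hd₂ : b ≤ deriv P J₂ := by
    have h := hconv.slope_le_deriv (mem_univ J₂') (mem_univ J₂) hJ₂'
      (hcon J₂ (right_mem_Icc.2 hJ))
    rw [slope_def_field] at h
    have hpos : 0 < J₂ - J₂' := sub_pos.2 hJ₂'
    exact ((le_div_iff₀ hpos).2 hP₂).trans h
  -- Darboux: `deriv P` takes the value `(a + b) / 2` inside the interval
  set m := (a + b) / 2 with hm
  have hderiv : ∀ x ∈ Icc J₁ J₂, HasDerivWithinAt P (deriv P x) (Icc J₁ J₂) x := fun x hx =>
    (hcon x hx).hasDerivAt.hasDerivWithinAt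
  obtain ⟨K, hK, hKm⟩ : m ∈ deriv P '' Ioo J₁ J₂ :=
    exists_hasDerivWithinAt_eq_of_gt_of_lt hJ hderiv (by linarith) (by linarith)
  have hKI : K ∈ Icc J₁ J₂ := Ioo_subset_Icc_self hK
  -- concentration at `K` puts mass `→ 1` in the band
  obtain ⟨θ, hθ, hfreq⟩ := hband K hKI
  have hη : 0 < (b - a) / 2 := by linarith
  have hconc := tendsto_real_tilted_deviation hH hbd hV hV0 hP (hcon K hKI) hη
  rw [hKm] at hconc
  have hband_eq : ∀ n, {ω | H n ω / V n ∈ Ioo a b} =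
      {ω | (b - a) / 2 ≤ |H n ω / V n - m|}ᶜ := by
    intro n
    ext ω
    simp only [mem_setOf_eq, mem_Ioo, mem_compl_iff, not_le, abs_sub_lt_iff, hm]
    constructor <;> intro h <;> constructor <;> linarith [h.1, h.2]
  have hmeas : ∀ n, MeasurableSet {ω | (b - a) / 2 ≤ |H n ω / V n - m|} := fun n =>
    measurableSet_le measurable_const (((hH n).div_const _).sub_const _).abs
  have hone : Tendsto (fun n => ((μ n).tilted fun ω => K * H n ω).real
      {ω | H n ω / V n ∈ Ioo a b}) atTop (𝓝 1) := by
    have h1 : ∀ n, ((μ n).tilted fun ω => K * H n ω).real {ω | H n ω / V n ∈ Ioo a b} =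
        1 - ((μ n).tilted fun ω => K * H n ω).real {ω | (b - a) / 2 ≤ |H n ω / V n - m|} := by
      intro n
      obtain ⟨C, hC⟩ := hbd n
      haveI := isProbabilityMeasure_tilted_mul (μ := μ n) (hH n) hC K
      rw [hband_eq n, probReal_compl_eq_one_sub (hmeas n)]
    simp_rw [h1]
    simpa using (tendsto_const_nhds (x := (1 : ℝ))).sub hconc
  have hev : ∀ᶠ n in atTop, θ < ((μ n).tilted fun ω => K * H n ω).real
      {ω | H n ω / V n ∈ Ioo a b} := hone.eventually (lt_mem_nhds hθ)
  exact hfreq (hev.mono fun n hn h => (lt_irrefl θ) (hn.trans_le h))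

end Volumes

end ForbiddenGap

end Literature.Probability.LatticeModels

end
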